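import Literature.Probability.RandomPlanarGeometry.LoewnerPartialContactHull
import Literature.Probability.RandomPlanarGeometry.LoewnerClusterSwallow
import Literature.Probability.RandomPlanarGeometry.LoewnerTraceLimit
import HarnessLib

/-!
# The generating curve keeps the margin `ρ` from the hull up to the partial contact time

Topic `Probability/RandomPlanarGeometry`; theorems only. Curve-side facts on the partial contact
time `Loewner.partialContactTime W A ρ` (`LoewnerPartialContact`, `LoewnerPartialContactHull`) of
a `*`-hull `A` for a chordal Loewner chain GENERATED BY A CURVE `γ` (continuous driving function
from `0`; `0 < ρ < infDist 0 A`), the input of the through-swallow image chain in the proof of the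
locality of SLE₆ (Lawler–Schramm–Werner (2001) Thm. 2.2; G. F. Lawler (2005) §6.3 Thm. 6.13):

* `le_infDist_apply_of_coe_le_partialContactTime` — **up to and including the partial contact time
  the curve stays `ρ`-far from `A`**: if `infDist (γ t) A < ρ`, the curve is in the open
  `ρ`-neighbourhood of a cluster `C`, inside its sensor; either `C` is then partially contacted at
  `t` — but the curve entered the open neighbourhood strictly earlier, an earlier partial contact —
  or `C` was swallowed whole at the first contact of its sensor, when the curve had not yet entered
  the open neighbourhood, which is therefore swallowed whole with it (`LoewnerClusterSwallow`) —
  but the curve never enters the interior of a past hull (`IsGeneratedByCurve.mem_closure_domain`);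
* consequently, up to the partial contact time the remaining hull `A ∖ K̂_t` is closed and every
  cluster is swallowed whole or missed (`isClosed_remHull_of_coe_le_partialContactTime`,
  `deltaCluster_subset_closedHull_or_disjoint_of_coe_le_partialContactTime`);
* `exists_infDist_apply_le_of_partialContactTime_eq` — **at a finite partial contact time the curve
  has come `ρ`-close to `A`**: a partial contact without the curve in the sensor would be a partial
  swallow of the sensor by a loop closed off it, impossible for the connected set "open
  neighbourhood ∪ a half-ball at the contact point" (`IsGeneratedByCurve.subset_closedHull_or_disjoint`).

## References

* G. F. Lawler, *Conformally Invariant Processes in the Plane* (2005), §6.3 Thm. 6.13, §4.4. [Lawler2005]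
* G. F. Lawler, O. Schramm, W. Werner, Acta Math. 187 (2001), Thm. 2.2. [LawlerSchrammWerner2001]
-/

noncomputable section

open Set Filter Topology Metric Bornology Complex
open UpperHalfPlane (upperHalfPlaneSet isOpen_upperHalfPlaneSet)
open scoped NNReal

namespace Literature.Probability.RandomPlanarGeometry

namespace Loewner

/-! ### Points of the open neighbourhood near a point of the sensor -/

/-- **Near every point of the sensor `halfNhd C ρ` there are points of `ℍ` strictly within `ρ` of
`C`** (`C ⊆ ℍ̄` nonempty, `ρ > 0`): the points `z + s (c − z) + i s ρ / 2`, `s ↓ 0`, with `c ∈ C`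
almost nearest to `z` (cf. `halfNhd_subset_closure_inter`). [folklore] -/
theorem exists_mem_upperHalfPlane_near_of_mem_halfNhd {C : Set ℂ} {ρ : ℝ} {z : ℂ}
    (hC : ∀ z ∈ C, 0 ≤ z.im) (hne : C.Nonempty) (hρ : 0 < ρ) (hz : z ∈ halfNhd C ρ) {ε : ℝ}
    (hε : 0 < ε) : ∃ w c : ℂ, c ∈ C ∧ dist w c < ρ ∧ 0 < w.im ∧ dist w z < ε := by
  -- adapted from `Loewner.halfNhd_subset_closure_inter` (`LoewnerPartialContact`)
  set s : ℝ := min 1 (ε / (4 * ρ)) with hs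
  have hs0 : 0 < s := lt_min one_pos (by positivity)
  have hs1 : s ≤ 1 := min_le_left _ _
  have hsε : 2 * s * ρ < ε := by
    have h1 : s ≤ ε / (4 * ρ) := min_le_right _ _
    have h2 : s * (4 * ρ) ≤ ε := (le_div_iff₀ (by positivity)).1 h1
    nlinarith
  obtain ⟨c, hc, hzc⟩ := (infDist_lt_iff hne).1 (show infDist z C < ρ + s * ρ / 4 by
    have := hz.2; nlinarith)
  set w : ℂ := z + (s : ℂ) * (c - z) + ((s * ρ / 2 : ℝ) : ℂ) * I with hw
  have hwim : w.im = (1 - s) * z.im + s * c.im + s * ρ / 2 := by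
    simp only [hw, add_im, mul_im, ofReal_re, ofReal_im, sub_im, sub_re, I_re, I_im, mul_zero,
      mul_one, zero_mul, add_zero]
    ring
  have hwpos : 0 < w.im := by
    rw [hwim]
    have h1 : 0 ≤ (1 - s) * z.im := mul_nonneg (by linarith) hz.1
    have h2 : 0 ≤ s * c.im := mul_nonneg hs0.le (hC c hc)
    have h3 : 0 < s * ρ / 2 := by positivity
    linarith
  have hsρ : 0 < s * ρ := mul_pos hs0 hρ
  have hssρ : s * s * ρ ≤ s * ρ := by nlinarith
  have hn2 : ‖((s * ρ / 2 : ℝ) : ℂ) * I‖ = s * ρ / 2 := by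
    rw [norm_mul, norm_real, norm_I, mul_one, Real.norm_of_nonneg (by positivity)]
  have hwc : dist w c < ρ := by
    have heq : w - c = ((1 - s : ℝ) : ℂ) * (z - c) + ((s * ρ / 2 : ℝ) : ℂ) * I := by
      simp only [hw, ofReal_sub, ofReal_one]; ring
    have hn1 : ‖((1 - s : ℝ) : ℂ) * (z - c)‖ = (1 - s) * dist z c := by
      rw [norm_mul, norm_real, Real.norm_of_nonneg (by linarith), dist_eq_norm]
    rw [dist_eq_norm, heq]
    calc ‖((1 - s : ℝ) : ℂ) * (z - c) + ((s * ρ / 2 : ℝ) : ℂ) * I‖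
        ≤ ‖((1 - s : ℝ) : ℂ) * (z - c)‖ + ‖((s * ρ / 2 : ℝ) : ℂ) * I‖ := norm_add_le _ _
      _ = (1 - s) * dist z c + s * ρ / 2 := by rw [hn1, hn2]
      _ ≤ (1 - s) * (ρ + s * ρ / 4) + s * ρ / 2 :=
          add_le_add (mul_le_mul_of_nonneg_left hzc.le (sub_nonneg.2 hs1)) le_rfl
      _ = ρ - s * ρ / 4 - s * s * ρ / 4 := by ring
      _ < ρ := by nlinarith
  have hwz : dist w z < ε := by
    have heq : w - z = (s : ℂ) * (c - z) + ((s * ρ / 2 : ℝ) : ℂ) * I := by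
      simp only [hw]; ring
    have hn1 : ‖(s : ℂ) * (c - z)‖ = s * dist c z := by
      rw [norm_mul, norm_real, Real.norm_of_nonneg hs0.le, dist_eq_norm]
    rw [dist_eq_norm, heq]
    calc ‖(s : ℂ) * (c - z) + ((s * ρ / 2 : ℝ) : ℂ) * I‖
        ≤ ‖(s : ℂ) * (c - z)‖ + ‖((s * ρ / 2 : ℝ) : ℂ) * I‖ := norm_add_le _ _
      _ = s * dist c z + s * ρ / 2 := by rw [hn1, hn2]
      _ ≤ s * (ρ + s * ρ / 4) + s * ρ / 2 := by
          rw [dist_comm]; exact add_le_add (mul_le_mul_of_nonneg_left hzc.le hs0.le) le_rfl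
      _ = s * ρ + s * s * ρ / 4 + s * ρ / 2 := by ring
      _ < ε := by linarith
  exact ⟨w, c, hc, hwc, hwpos, hwz⟩

/-! ### The curve and the sensors -/

section Curve

variable {W : ℝ≥0 → ℝ} {γ : ℝ≥0 → ℂ} {A : Set ℂ} {ρ : ℝ}
  (hγ : IsGeneratedByCurve W γ) (hW : Continuous W) (hW0 : W 0 = 0)
  (hA : IsStarHull A) (hne : A.Nonempty) (hρ : 0 < ρ) (hρ0 : ρ < infDist 0 A)

include hγ hW in
/-- `γ s ∈ K̂_s`: the present point of a generating curve lies in the closed hull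
(`IsGeneratedByCurve.image_Icc_subset_closure_hull`). [cite: Lawler2005, Ch. 4 §4.1] -/
theorem IsGeneratedByCurve.apply_mem_closedHull (s : ℝ≥0) : γ s ∈ closedHull W s := by
  rcases eq_zero_or_pos (a := s) with hs | hs
  · subst hs
    rw [hγ.apply_zero]
    exact ⟨by simp, (swallowingTime_driving_le W).trans bot_le⟩
  · exact closure_minimal (hull_subset_closedHull W s) (isClosed_closedHull hW s)
      (hγ.image_Icc_subset_closure_hull hW hs ⟨s, ⟨bot_le, le_rfl⟩, rfl⟩)

include hγ hW0 hρ0 in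
/-- **The curve enters an open cluster neighbourhood strictly before any time at which it is in
it** (the neighbourhood is relatively open in `ℍ̄`, the curve continuous, and `γ 0 = 0` is off the
neighbourhood). [folklore] -/
theorem IsGeneratedByCurve.exists_lt_apply_mem_deltaClusterNhd {a : ℂ} (ha : a ∈ A) {t : ℝ≥0}
    (ht : γ t ∈ deltaClusterNhd A ρ a) : ∃ s < t, γ s ∈ deltaClusterNhd A ρ a := by
  have ht0 : 0 < t := by
    rcases eq_zero_or_pos (a := t) with h | h
    · subst h
      rw [hγ.apply_zero, hW0, Complex.ofReal_zero] at ht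
      exact absurd ht (zero_notMem_deltaClusterNhd ha hρ0.le)
    · exact h
  obtain ⟨U, hUo, hUeq⟩ := exists_isOpen_deltaClusterNhd_eq (A := A) (δ := ρ) (a := a)
  have htU : γ t ∈ U := by rw [hUeq] at ht; exact ht.1
  have hev : ∀ᶠ s in 𝓝 t, γ s ∈ U := hγ.continuous.continuousAt (hUo.mem_nhds htU)
  haveI : (𝓝[<] t).NeBot := nhdsLT_neBot_of_exists_lt ⟨0, ht0⟩
  have hev' : ∀ᶠ s in 𝓝[<] t, γ s ∈ U := hev.filter_mono nhdsWithin_le_nhds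
  obtain ⟨s, hsU, hst⟩ := (hev'.and self_mem_nhdsWithin).exists
  exact ⟨s, hst, by rw [hUeq]; exact ⟨hsU, hγ.im_nonneg s⟩⟩

include hγ hW hW0 hA hne hρ hρ0 in
/-- **Up to and including the partial contact time the curve is `ρ`-far from `A`.** See the module
docstring for the proof. [cite: Lawler2005, §6.3 Thm. 6.13] -/
theorem le_infDist_apply_of_coe_le_partialContactTime {t : ℝ≥0}
    (ht : (t : WithTop ℝ≥0) ≤ partialContactTime W A ρ) : ρ ≤ infDist (γ t) A := by
  have him : ∀ z ∈ A, 0 ≤ z.im := fun z hz ↦ hA.isBoundedHull.im_nonneg hz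
  by_contra hlt
  rw [not_le] at hlt
  obtain ⟨a, ha, hda⟩ := (infDist_lt_iff hne).1 hlt
  have hmemO : γ t ∈ deltaClusterNhd A ρ a := ⟨hγ.im_nonneg t, a, mem_deltaCluster_self A ρ a, hda⟩
  set C : Set ℂ := deltaCluster A ρ a with hCdef
  have hC : C ∈ clusterFamily A ρ := deltaCluster_mem_clusterFamily ha
  obtain ⟨hCb, hCne, -, -, -⟩ := clusterFamily_facts hA hρ hC
  have hOsub : deltaClusterNhd A ρ a ⊆ halfNhd C ρ := fun z hz ↦ by
    obtain ⟨hzim, c, hc, hzc⟩ := hz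
    exact mem_halfNhd_of_dist_le hzim hc hzc.le
  have hCO : C ⊆ deltaClusterNhd A ρ a := deltaCluster_subset_deltaClusterNhd him ha hρ
  have hcont : ¬ Disjoint (closedHull W t) (halfNhd C ρ) :=
    Set.not_disjoint_iff.2 ⟨γ t, hγ.apply_mem_closedHull hW t, hOsub hmemO⟩
  have htC : (t : WithTop ℝ≥0) ≤ clusterContactTime W C ρ := ht.trans (partialContactTime_le hC)
  by_cases hsub : C ⊆ closedHull W t
  · -- `C` is wholly swallowed at `t`: it was swallowed at the first contact `ν` of its sensor
    have hτle : hullHitTime W (halfNhd C ρ) ≤ t := hullHitTime_le hcont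
    obtain ⟨ν, hν⟩ := WithTop.ne_top_iff_exists.1 (ne_top_of_le_ne_top WithTop.coe_ne_top hτle)
    have hν' : hullHitTime W (halfNhd C ρ) = ν := hν.symm
    have hνt : ν ≤ t := by rw [hν'] at hτle; exact WithTop.coe_le_coe.1 hτle
    have hcontν : ¬ Disjoint (closedHull W ν) (halfNhd C ρ) :=
      not_disjoint_closedHull_of_hullHitTime_eq hW (isCompact_halfNhd hCb hCne ρ) hν'
    have hbefore : ∀ s < ν, Disjoint (closedHull W s) (halfNhd C ρ) := fun s hs ↦
      disjoint_closedHull_of_lt_hullHitTime (by rw [hν']; exact_mod_cast hs)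
    have hsubν : C ⊆ closedHull W ν := by
      by_contra hns
      have h2 : (t : WithTop ℝ≥0) ≤ ν := htC.trans (clusterContactTime_le ⟨hcontν, hns⟩)
      have h3 : ν = t := le_antisymm hνt (WithTop.coe_le_coe.1 h2)
      rw [h3] at hns
      exact hns hsub
    -- the curve has not entered the open neighbourhood by time `ν`
    have hkey : ∀ r ≤ ν, γ r ∉ deltaClusterNhd A ρ a := by
      intro r hr hrO
      rcases hr.lt_or_eq with hlt' | heq
      · exact Set.disjoint_left.1 (hbefore r hlt') (hγ.apply_mem_closedHull hW r) (hOsub hrO)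
      · subst heq
        obtain ⟨s', hs', hs'O⟩ := hγ.exists_lt_apply_mem_deltaClusterNhd hW0 hρ0 ha hrO
        exact Set.disjoint_left.1 (hbefore s' hs') (hγ.apply_mem_closedHull hW s') (hOsub hs'O)
    have hdisj : Disjoint (deltaClusterNhd A ρ a) (γ '' Icc 0 ν) := by
      refine Set.disjoint_left.2 ?_
      rintro _ hzO ⟨s, hs, rfl⟩
      exact hkey s hs.2 hzO
    rcases hγ.deltaClusterNhd_subset_closedHull_or_disjoint hW hW0 hA hρ hρ0.le ha hdisj with hO | hO
    · -- the open neighbourhood is swallowed by time `ν ≤ t`, but the curve is in it at time `t`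
      obtain ⟨U, hUo, hUeq⟩ := exists_isOpen_deltaClusterNhd_eq (A := A) (δ := ρ) (a := a)
      have htU : γ t ∈ U := by rw [hUeq] at hmemO; exact hmemO.1
      have hcl : γ t ∈ closure (domain W t) := hγ.mem_closure_domain hW le_rfl
      obtain ⟨w, hwU, hwD⟩ := mem_closure_iff_nhds.1 hcl U (hUo.mem_nhds htU)
      have hwH : w ∈ upperHalfPlaneSet := domain_subset W t hwD
      have hwO : w ∈ deltaClusterNhd A ρ a := by
        rw [hUeq]; exact ⟨hwU, le_of_lt (show (0 : ℝ) < w.im from hwH)⟩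
      have hwK : w ∈ closedHull W t := closedHull_mono W hνt (hO hwO)
      exact hwD.2 ⟨hwH, hwK.2⟩
    · exact Set.disjoint_left.1 hO (hCO (mem_deltaCluster_self A ρ a))
        (hsubν (mem_deltaCluster_self A ρ a))
  · -- partial contact at `t`: the curve was in the open neighbourhood strictly earlier
    have heq : clusterContactTime W C ρ = t := le_antisymm (clusterContactTime_le ⟨hcont, hsub⟩) htC
    obtain ⟨s, hst, hsO⟩ := hγ.exists_lt_apply_mem_deltaClusterNhd hW0 hρ0 ha hmemO
    have hbad' : IsPartialContact W C ρ s :=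
      ⟨Set.not_disjoint_iff.2 ⟨γ s, hγ.apply_mem_closedHull hW s, hOsub hsO⟩,
        fun h ↦ hsub (h.trans (closedHull_mono W hst.le))⟩
    have := clusterContactTime_le hbad'
    rw [heq, WithTop.coe_le_coe] at this
    exact absurd hst (not_lt.2 this)

include hγ hW hW0 hA hne hρ hρ0 in
/-- Up to and including the partial contact time the curve is off `A`. [folklore] -/
theorem apply_notMem_of_coe_le_partialContactTime {t : ℝ≥0}
    (ht : (t : WithTop ℝ≥0) ≤ partialContactTime W A ρ) : γ t ∉ A := fun h ↦ by
  have := le_infDist_apply_of_coe_le_partialContactTime hγ hW hW0 hA hne hρ hρ0 ht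
  rw [infDist_zero_of_mem h] at this
  exact absurd this (not_le.2 hρ)

include hγ hW hW0 hA hne hρ hρ0 in
/-- **Up to and including the partial contact time the remaining hull `A ∖ K̂_t` is closed** (the
curve being `ρ`-far, the swallowed part is a union of clusters, `LoewnerClusterSwallow`).
[cite: Lawler2005, §6.3 Thm. 6.13] -/
theorem isClosed_remHull_of_coe_le_partialContactTime {t : ℝ≥0}
    (ht : (t : WithTop ℝ≥0) ≤ partialContactTime W A ρ) : IsClosed (remHull W A t) :=
  hγ.isClosed_diff_closedHull hW hW0 hA hρ hρ0.le fun _ hs ↦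
    le_infDist_apply_of_coe_le_partialContactTime hγ hW hW0 hA hne hρ hρ0 ((WithTop.coe_le_coe.2 hs).trans ht)

include hγ hW hW0 hA hne hρ hρ0 in
/-- **Up to and including the partial contact time every cluster is swallowed whole or missed.**
[cite: Lawler2005, §6.3 Thm. 6.13] -/
theorem deltaCluster_subset_closedHull_or_disjoint_of_coe_le_partialContactTime {t : ℝ≥0}
    (ht : (t : WithTop ℝ≥0) ≤ partialContactTime W A ρ) {a : ℂ} (ha : a ∈ A) :
    deltaCluster A ρ a ⊆ closedHull W t ∨ Disjoint (deltaCluster A ρ a) (closedHull W t) := by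
  have hfar : ∀ s ≤ t, ρ ≤ infDist (γ s) A := fun s hs ↦
    le_infDist_apply_of_coe_le_partialContactTime hγ hW hW0 hA hne hρ hρ0 ((WithTop.coe_le_coe.2 hs).trans ht)
  by_cases h : ∃ c ∈ deltaCluster A ρ a, c ∈ closedHull W t
  · obtain ⟨c, hc, hcK⟩ := h
    left
    rw [← deltaCluster_eq_of_mem hc]
    exact hγ.deltaCluster_subset_closedHull hW hW0 hA hρ hρ0.le hfar (deltaCluster_subset ha hc) hcK
  · right
    push Not at h
    exact Set.disjoint_left.2 fun c hc hcK ↦ h c hc hcK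

include hγ hW hW0 hA hρ hρ0 in
/-- **At a finite partial contact time the curve has come `ρ`-close to `A`.** See the module
docstring for the proof. [cite: Lawler2005, §6.3 Thm. 6.13] -/
theorem exists_infDist_apply_le_of_partialContactTime_eq {u : ℝ≥0}
    (hu : partialContactTime W A ρ = u) : ∃ s ≤ u, infDist (γ s) A ≤ ρ := by
  have him : ∀ z ∈ A, 0 ≤ z.im := fun z hz ↦ hA.isBoundedHull.im_nonneg hz
  have hAK := hA.isBoundedHull.isCompact
  rcases partialContactTime_eq_top_or_exists hAK hρ (W := W) with htop | ⟨C, hC, hCeq⟩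
  · rw [hu] at htop; exact absurd htop WithTop.coe_ne_top
  rw [hu] at hCeq
  obtain ⟨hCb, hCne, -, hCH, hdist⟩ := clusterFamily_facts hA hρ hC
  obtain ⟨a, ha, rfl⟩ := hC
  have hOsub : deltaClusterNhd A ρ a ⊆ halfNhd (deltaCluster A ρ a) ρ := fun z hz ↦ by
    obtain ⟨hzim, c, hc, hzc⟩ := hz
    exact mem_halfNhd_of_dist_le hzim hc hzc.le
  have hCO : deltaCluster A ρ a ⊆ deltaClusterNhd A ρ a := deltaCluster_subset_deltaClusterNhd him ha hρ
  -- partial contact at `u` itself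
  obtain ⟨s, -, hs⟩ := (clusterContactTime_le_coe_iff hW hCb hCne).1 hCeq.symm.le
  obtain ⟨τ, hτ', -, hbad⟩ := hs.exists_hullHitTime_eq hW hCb hCne
  have hτu : (τ : WithTop ℝ≥0) = u := by
    rw [← hτ', ← clusterContactTime_eq_hullHitTime hW hCb hCne hs, ← hCeq]
  obtain rfl : τ = u := WithTop.coe_injective hτu
  -- suppose the curve stays strictly `ρ`-far from `A` on `[0, u]`
  by_contra hcon
  push Not at hcon
  have hnotN : ∀ s ≤ τ, γ s ∉ halfNhd (deltaCluster A ρ a) ρ := fun s hs hmem ↦ by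
    have h1 : infDist (γ s) A ≤ infDist (γ s) (deltaCluster A ρ a) :=
      infDist_le_infDist_of_subset (deltaCluster_subset ha) hCne
    exact absurd (h1.trans hmem.2) (not_le.2 (hcon s hs))
  -- a contact point `z`, off the curve and `≠ 0`
  obtain ⟨z, hzK, hzN⟩ := Set.not_disjoint_iff.1 hbad.1
  set Γ : Set ℂ := γ '' Icc 0 τ with hΓ
  have hΓc : IsCompact Γ := isCompact_Icc.image hγ.continuous
  have hzΓ : z ∉ Γ := by
    rintro ⟨s, hs, hsz⟩
    exact hnotN s hs.2 (hsz ▸ hzN)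
  obtain ⟨ε₁, hε₁, hball₁⟩ := Metric.isOpen_iff.1 hΓc.isClosed.isOpen_compl z hzΓ
  have hz0 : z ≠ 0 := fun h ↦ zero_notMem_halfNhd (hρ0.trans_le hdist) (h ▸ hzN)
  set ε : ℝ := min ε₁ ‖z‖ with hεdef
  have hε : 0 < ε := lt_min hε₁ (norm_pos_iff.2 hz0)
  -- a point of the open neighbourhood in `ℍ` near `z`
  obtain ⟨w, c, hc, hwc, hwim, hwz⟩ := exists_mem_upperHalfPlane_near_of_mem_halfNhd hCH hCne hρ hzN hε
  have hwO : w ∈ deltaClusterNhd A ρ a := ⟨hwim.le, c, hc, hwc⟩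
  -- the connected set `O ∪ half-ball at z`
  set Cz : Set ℂ := deltaClusterNhd A ρ a ∪ (ball z ε ∩ {x : ℂ | 0 ≤ x.im}) with hCz
  have hCim : ∀ x ∈ Cz, 0 ≤ x.im := by
    rintro x (hx | hx)
    exacts [hx.1, hx.2]
  have hC0 : (0 : ℂ) ∉ Cz := by
    rintro (h | h)
    · exact zero_notMem_deltaClusterNhd ha hρ0.le h
    · have h1 : dist (0 : ℂ) z < ε := mem_ball.1 h.1
      rw [dist_comm, dist_zero_right] at h1
      exact absurd (min_le_right ε₁ ‖z‖) (not_le.2 h1)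
  have hCγ : Disjoint Cz Γ := by
    refine Set.disjoint_left.2 ?_
    rintro x (hx | hx) hxΓ
    · obtain ⟨s, hs, rfl⟩ := hxΓ
      exact hnotN s hs.2 (hOsub hx)
    · exact hball₁ (ball_subset_ball (min_le_left _ _) hx.1) hxΓ
  have hconn : IsPreconnected (Cz ∩ upperHalfPlaneSet) := by
    rw [hCz, union_inter_distrib_right]
    refine IsPreconnected.union w ⟨hwO, hwim⟩ ⟨⟨mem_ball.2 hwz, hwim.le⟩, hwim⟩
      (isPreconnected_deltaClusterNhd_inter him) ?_
    exact (((convex_ball z ε).inter (convex_halfSpace_im_ge 0)).inter (convex_halfSpace_im_gt 0)).isPreconnected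
  have hCne' : (Cz ∩ upperHalfPlaneSet).Nonempty := ⟨w, Or.inl hwO, hwim⟩
  have hCup : ∀ x : ℝ, (x : ℂ) ∈ Cz → ∀ᶠ ε' : ℝ in 𝓝[>] 0, (x : ℂ) + ε' * I ∈ Cz := by
    rintro x (hx | hx)
    · obtain ⟨-, c', hc', hxc'⟩ := hx
      have hgap : 0 < ρ - dist (x : ℂ) c' := sub_pos.2 hxc'
      filter_upwards [Ioo_mem_nhdsGT hgap] with ε' hε'
      refine Or.inl ⟨by simp [hε'.1.le], c', hc', ?_⟩
      calc dist ((x : ℂ) + ε' * I) c' ≤ dist ((x : ℂ) + ε' * I) x + dist (x : ℂ) c' := dist_triangle _ _ _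
        _ = ε' + dist (x : ℂ) c' := by
            rw [dist_eq_norm, add_sub_cancel_left, norm_mul, norm_real, norm_I, mul_one,
              Real.norm_of_nonneg hε'.1.le]
        _ < ρ := by linarith [hε'.2]
    · obtain ⟨r, hr, hrsub⟩ := Metric.isOpen_iff.1 isOpen_ball (x : ℂ) hx.1
      filter_upwards [Ioo_mem_nhdsGT hr] with ε' hε'
      refine Or.inr ⟨hrsub ?_, by simp [hε'.1.le]⟩
      rw [mem_ball, dist_eq_norm, add_sub_cancel_left, norm_mul, norm_real, norm_I, mul_one,
        Real.norm_of_nonneg hε'.1.le]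
      exact hε'.2
  rcases hγ.subset_closedHull_or_disjoint hW hW0 hCim hC0 hCγ hconn hCne' hCup with h | h
  · exact hbad.2 ((hCO.trans subset_union_left).trans h)
  · exact Set.disjoint_left.1 h (Or.inr ⟨mem_ball_self hε, hzN.1⟩) hzK

end Curve

end Loewner

end Literature.Probability.RandomPlanarGeometry

end
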